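import Literature.NumberTheory.Rogawski1990.OccurrenceRealisationTwoForms
import Literature.NumberTheory.QuadraticForms.HermitianSignatureCongruence
import HarnessLib

/-!
# Occurrence from invariants: `γ ∈ U(H)(L⁺)` occurs in `U(H′)(L⁺)` as soon as some `γ`-invariant form `H · x` has the local invariants of `H′`
# (Rogawski 1990, §14.1 p. 232, §3.3 Prop. 3.3.1 p. 22; Landherr 1936)

Topic `NumberTheory/Rogawski1990`; namespace `Literature.NumberTheory.Rogawski1990`; **THEOREMS ONLY** (no definition, no named fact, no instance, no
notation, no `sorry`).  Cell `pub/hodgecm-mathlib`, ENGINE T1 (crux H413 = `stmt-HodgeConjecture-24833`), row «T1b-VANISH ∕ occurrence local–global» (F0P3a-p01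
(g5)), brick (v) = the ASSEMBLY: for non-degenerate hermitian `H, H′ ∈ M_n(L)` over the CM field `L`, `γ ∈ U(H)(L⁺)` and `x ∈ Z(γ)` with `x⋆ = x` (so `H·x` is
hermitian), if `H · x` and `H′` are congruent over `ℂ` at EVERY complex embedding and `det(H·x) = det H′ · z z̄` for some `z ∈ Lˣ`, then ★ LANDHERR (local-at-∞
form `QuadraticForms.congruent_of_forall_embedding_congruent_of_det`) makes `H′ ≅_L H·x`, and ★ `conj_mem_unitaryGroup_of_twistGram_eq_mul₂` turns the congruence
into `γ′ ∈ U(H′)(L⁺)` conjugate to `γ` in `GL_n(L)` — «`γ` OCCURS in `U(H′)`».  What remains for the occurrence local–global row is to PRODUCE such an `x` from an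
archimedean match (census `CENSUS-T1bVanish-Occurrence` §2 (iii)(iv): the `L⁺`-factor choice in `Z(γ) ≅ L[h] × L`).  HC_CM is proved only modulo the printed
citations until rung 0 closes.

* `twistGram_inv_eq_of_congr` — bookkeeping: `ᵗ(σg) (H x) g = H′ ⇒ twistGram σ H′ g⁻¹ = H x`.
* **`exists_unitary_isConj_of_forall_embedding_congruent_of_det`** — the assembly.

## References
* [Rogawski1990] J. D. Rogawski, *Automorphic Representations of Unitary Groups in Three Variables*, Ann. of Math. Stud. 123 (1990), §3.3 Prop. 3.3.1 p. 22, §14.1 p. 232.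
* [Landherr1936HermitianForms] W. Landherr, *Äquivalenz Hermitescher Formen über einem beliebigen algebraischen Zahlkörper*, Abh. Math. Sem. Hamburg 11 (1936).
-/

set_option autoImplicit false

noncomputable section

namespace Literature.NumberTheory.Rogawski1990

open scoped MatrixGroups Matrix
open Literature.AlgebraicGeometry.ShimuraVarieties (unitaryGroup mem_unitaryGroup_iff)
open NumberField

section Assembly

variable (L : Type) [Field L] [NumberField L] [IsCMField L] {n : Type} [Fintype n] [DecidableEq n]

/-- Bookkeeping: a congruence `ᵗ(σg) · K · g = H′` with `g ∈ GL_n` reads `twistGram σ H′ g⁻¹ = K`. [cite: Rogawski1990, §3.1 p. 19] -/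
theorem twistGram_inv_eq_of_congr {R : Type*} [CommRing R] (σ : R →+* R) {K H' : Matrix n n R} {g : GL n R}
    (hg : ((g : Matrix n n R).map σ)ᵀ * K * (g : Matrix n n R) = H') : twistGram σ H' ((g⁻¹ : GL n R) : Matrix n n R) = K := by
  rw [twistGram_def, ← hg]
  have h1 : ((((g⁻¹ : GL n R) : Matrix n n R)).map σ)ᵀ * ((g : Matrix n n R).map σ)ᵀ = 1 := by
    rw [← Matrix.transpose_mul, ← Matrix.map_mul, ← Units.val_mul, mul_inv_cancel, Units.val_one, Matrix.map_one σ (map_zero σ) (map_one σ),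
      Matrix.transpose_one]
  have h2 : (g : Matrix n n R) * ((g⁻¹ : GL n R) : Matrix n n R) = 1 := by rw [← Units.val_mul, mul_inv_cancel, Units.val_one]
  calc ((((g⁻¹ : GL n R) : Matrix n n R)).map σ)ᵀ * (((g : Matrix n n R).map σ)ᵀ * K * (g : Matrix n n R)) * ((g⁻¹ : GL n R) : Matrix n n R)
      = (((((g⁻¹ : GL n R) : Matrix n n R)).map σ)ᵀ * ((g : Matrix n n R).map σ)ᵀ) * K * ((g : Matrix n n R) * ((g⁻¹ : GL n R) : Matrix n n R)) := by
        simp only [Matrix.mul_assoc]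
    _ = K := by rw [h1, h2, Matrix.one_mul, Matrix.mul_one]

/-- **OCCURRENCE FROM INVARIANTS.**  `H′ ∈ M_n(L)` non-degenerate hermitian over the CM field `L`, `H ∈ M_n(L)` any form (`σ` = complex conjugation), `γ ∈ U(H)(L⁺)`, and a
`γ`-invariant hermitian form `H · x` (`x` commuting with `γ`, `H·x` hermitian with `det ≠ 0`) which is congruent to `H′` over `ℂ` at every complex embedding and
has `det(H·x) = det H′ · z σ(z)`, `z ≠ 0`: then some `γ′ ∈ U(H′)(L⁺)` is `GL_n(L)`-conjugate to `γ` — `γ` OCCURS in `U(H′)` ([Rogawski1990] §14.1).  Landherr ★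
`congruent_of_forall_embedding_congruent_of_det` + ★ `conj_mem_unitaryGroup_of_twistGram_eq_mul₂`. [cite: Rogawski1990, §14.1 p. 232; §3.3 Prop. 3.3.1 p. 22]
[cite: Landherr1936HermitianForms] -/
theorem exists_unitary_isConj_of_forall_embedding_congruent_of_det {H H' : Matrix n n L}
    (hH' : (H'.map (IsCMField.complexConj L : L →+* L))ᵀ = H') (h0' : H'.det ≠ 0)
    {γ : GL n L} (hγ : γ ∈ unitaryGroup (IsCMField.complexConj L : L →+* L) H) {x : Matrix n n L} (hx : Commute x (γ : Matrix n n L))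
    (hHx : ((H * x).map (IsCMField.complexConj L : L →+* L))ᵀ = H * x) (h0x : (H * x).det ≠ 0)
    (hloc : ∀ τ : L →+* ℂ, ∃ g : GL n ℂ, (g : Matrix n n ℂ)ᴴ * (H * x).map τ * (g : Matrix n n ℂ) = H'.map τ)
    (hdet : ∃ z : L, z ≠ 0 ∧ (H * x).det = H'.det * (z * IsCMField.complexConj L z)) :
    ∃ γ' : unitaryGroup (IsCMField.complexConj L : L →+* L) H', IsConj γ (γ' : GL n L) := by
  have hHx' : (H * x).transpose.map (IsCMField.complexConj L) = H * x := by rw [Matrix.transpose_map]; exact hHx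
  have hH'' : H'.transpose.map (IsCMField.complexConj L) = H' := by rw [Matrix.transpose_map]; exact hH'
  obtain ⟨g, hg⟩ := Literature.NumberTheory.QuadraticForms.congruent_of_forall_embedding_congruent_of_det L (H * x) H' hHx' hH'' h0x h0' hloc hdet
  have hg' : (((g : Matrix n n L)).map (IsCMField.complexConj L : L →+* L))ᵀ * (H * x) * (g : Matrix n n L) = H' := by
    rw [← Matrix.transpose_map]; exact hg
  obtain ⟨δ, -, hδ⟩ := exists_unitary_isConj_of_twistGram_eq_mul₂ (IsCMField.complexConj L : L →+* L) H H' hγ hx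
    (twistGram_inv_eq_of_congr (IsCMField.complexConj L : L →+* L) hg')
  exact ⟨δ, hδ⟩

end Assembly

end Literature.NumberTheory.Rogawski1990

end
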